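import Literature.Geometry.Lorentzian.KissingBallsCutMass
import Literature.Geometry.Lorentzian.CausalityPushUp
import HarnessLib

/-!
# Minkowski spacetime has no event horizon (ray-theoretic form)

Stub `stub_minkowskiNoHorizon` (W2a) of the line `birth` for the crux `HorizonlessMustDrain` of
route `BondiDrainDispersal` (item stmt-FinalStateConjecture-9976,
`Summit.FinalStateConjecture.FinalStateConjecture.Theses.BondiDrainDispersal`).

The no-horizon hypothesis of the crux, in its ray-theoretic form, says that it is *false* that some
event `q` lies outside the chronological past `I⁻(γ(dom ∩ [0, ∞)))` of every future-complete
normalised null ray `γ` from the data hypersurface. We discharge it on the Minkowski development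
`Literature.Geometry.Lorentzian.Minkowski.vacuumCauchyDevelopment` of the trivial datum
`(ℝ³, δ, 0)` (carrier `E4`, metric `η`, time orientation `∂ₜ`, embedding `y ↦ (0, y)` of the slice
`{t = 0} = ℝ³`, unit normal `∂ₜ`): every event `q = (t, x)` lies in the chronological past of the
point `(a, x)`, `a = |t| + 1 > t`, and `(a, x)` is the point of affine parameter `a ≥ 0` of the
straight null ray `s ↦ (s, (x - a e) + s e)` (`Minkowski.nullRay (x - a e) e`, `e` a unit vector)
from the slice point `(0, x - a e)`, which is a normalised future null ray with affine domain all of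
`ℝ` (`Minkowski.isNormalisedNullRayFrom_nullRay`), in particular future-complete
(`¬ BddAbove univ`). This is the pattern of `Minkowski.ofTimeSpace_mem_visibleRegion`
(`KissingBallsCutMass.lean`), run for an arbitrary event instead of a slice point: in Minkowski
spacetime the domain of outer communications `I⁻(𝓘⁺)` is everything (Wald 1984, §12.1, p. 300;
Hawking–Ellis 1973, §5.1).

## References

* R. M. Wald, *General Relativity*, University of Chicago Press 1984, §12.1, p. 300.
* S. W. Hawking, G. F. R. Ellis, *The large scale structure of space-time*, CUP 1973, §5.1.
* B. O'Neill, *Semi-Riemannian geometry with applications to relativity*, Academic Press 1983,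
  Ch. 14, p. 402 (`I⁺(p)` in Minkowski space).
-/

set_option linter.dupNamespace false

noncomputable section

open Set

open Literature.Geometry.Lorentzian

namespace Summit.FinalStateConjecture.FinalStateConjecture.Theorems
namespace BondiDrainDispersalHorizonlessMustDrain

namespace StubMinkowskiNoHorizon

/-- **Every event `(t, x)` of the Minkowski development is in the chronological past of the forward
half of a straight null ray from the slice**: with `a = |t| + 1`, the point `(a, x)` of parameter
`a ≥ 0` of the ray `s ↦ (s, (x - a e) + s e)` has the same spatial part as `(t, x)` and a larger
time, so `(t, x) ≪ (a, x)` (`Minkowski.mem_chronologicalFuture_of_spatial_eq`, time duality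
`LorentzianMetric.mem_chronologicalPast_of_mem_chronologicalFuture`, monotonicity of `I⁻`).
O'Neill 1983, Ch. 14, p. 402; Wald 1984, §12.1, p. 300. -/
theorem ofTimeSpace_mem_chronologicalPast_image_nullRay (t : ℝ) (x e : E3) :
    E4.ofTimeSpace t x ∈
      (Minkowski.vacuumCauchyDevelopment.metric.chronologicalPast
        Minkowski.vacuumCauchyDevelopment.timeOrientation
        (Minkowski.nullRay (x - (|t| + 1) • e) e '' (univ ∩ Ici 0)) : Set E4) := by
  have ha0 : 0 ≤ |t| + 1 := by positivity
  have hta : t < |t| + 1 := by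
    have := le_abs_self t
    linarith
  have hk : E4.ofTimeSpace t x ∈
      (Minkowski.vacuumCauchyDevelopment.metric.chronologicalPast
        Minkowski.vacuumCauchyDevelopment.timeOrientation
        {Minkowski.nullRay (x - (|t| + 1) • e) e (|t| + 1)} : Set E4) := by
    refine LorentzianMetric.mem_chronologicalPast_of_mem_chronologicalFuture
      (g := Minkowski.vacuumCauchyDevelopment.metric)
      (Minkowski.mem_chronologicalFuture_of_spatial_eq ?_ ?_)
    · rw [Minkowski.nullRay_apply, E4.spatial_ofTimeSpace, E4.spatial_ofTimeSpace, sub_add_cancel]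
    · rw [Minkowski.nullRay_apply, E4.ofTimeSpace_apply_zero, E4.ofTimeSpace_apply_zero]
      exact hta
  have hmem : Minkowski.nullRay (x - (|t| + 1) • e) e (|t| + 1) ∈
      Minkowski.nullRay (x - (|t| + 1) • e) e '' (univ ∩ Ici 0) :=
    ⟨|t| + 1, ⟨mem_univ _, ha0⟩, rfl⟩
  exact LorentzianMetric.chronologicalFuture_mono (g := Minkowski.vacuumCauchyDevelopment.metric)
    (singleton_subset_iff.2 hmem) hk

/-- **Every event of the Minkowski development is visible from a future-complete normalised null
ray from the slice**: `q = (t, x)` lies in `I⁻(γ(univ ∩ [0, ∞)))` for the straight null ray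
`γ = Minkowski.nullRay (x - (|t| + 1) e₀) e₀`, `e₀` the first coordinate unit vector, which is a
normalised future null ray from the slice point `x - (|t| + 1) e₀` with affine domain `ℝ`
(`Minkowski.isNormalisedNullRayFrom_nullRay`). Wald 1984, §12.1, p. 300. -/
theorem exists_ray_mem_chronologicalPast
    [Minkowski.vacuumCauchyDevelopment.metric.HasLeviCivita]
    (q : Minkowski.vacuumCauchyDevelopment.carrier) :
    ∃ (p : Minkowski.slice) (γ : ℝ → Minkowski.vacuumCauchyDevelopment.carrier) (dom : Set ℝ),
      Minkowski.vacuumCauchyDevelopment.metric.IsNormalisedNullRayFrom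
          Minkowski.vacuumCauchyDevelopment.timeOrientation Minkowski.vacuumCauchyDevelopment.embed
          Minkowski.vacuumCauchyDevelopment.normal p γ dom ∧
        ¬ BddAbove dom ∧
        q ∈ Minkowski.vacuumCauchyDevelopment.metric.chronologicalPast
          Minkowski.vacuumCauchyDevelopment.timeOrientation (γ '' (dom ∩ Ici 0)) := by
  have he : ‖(EuclideanSpace.single 0 (1 : ℝ) : E3)‖ = 1 := Minkowski.norm_single_one 0
  refine ⟨⟨_, Minkowski.mem_slice _⟩, _, univ,
    Minkowski.isNormalisedNullRayFrom_nullRay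
      (E4.spatial q - (|E4.time q| + 1) • (EuclideanSpace.single 0 (1 : ℝ) : E3)) he,
    not_bddAbove_univ, ?_⟩
  have h := ofTimeSpace_mem_chronologicalPast_image_nullRay (E4.time q) (E4.spatial q)
    (EuclideanSpace.single 0 (1 : ℝ) : E3)
  rw [E4.ofTimeSpace_time_spatial] at h
  exact h

end StubMinkowskiNoHorizon

/-- **W2a — MINKOWSKI SPACE HAS NO EVENT HORIZON (ray-theoretic form).** For the vacuum Cauchy
development `Minkowski.vacuumCauchyDevelopment` of the trivial datum `(ℝ³, δ, 0)` it is false that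
some event lies outside the chronological past `I⁻(γ(dom ∩ [0, ∞)))` of every future-complete
normalised null ray `γ` from the slice: every event `(t, x)` is in the chronological past of the
point `(|t| + 1, x)` of the future-complete straight null ray `s ↦ (s, x - (|t| + 1 - s) e₀)` from
the slice (`StubMinkowskiNoHorizon.exists_ray_mem_chronologicalPast`); the Levi-Civita instance
binder is fed with `PseudoRiemannianMetric.hasLeviCivita`. In Minkowski spacetime `I⁻(𝓘⁺)` is the
whole spacetime: Wald 1984, §12.1, p. 300; Hawking–Ellis 1973, §5.1. -/
theorem stub_minkowskiNoHorizon :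
    ¬ (∀ [Literature.Geometry.Lorentzian.Minkowski.vacuumCauchyDevelopment.metric.HasLeviCivita],
        ∃ q : Literature.Geometry.Lorentzian.Minkowski.vacuumCauchyDevelopment.carrier,
          ∀ (p : Literature.Geometry.Lorentzian.Minkowski.slice)
            (γ : ℝ → Literature.Geometry.Lorentzian.Minkowski.vacuumCauchyDevelopment.carrier) (dom : Set ℝ),
            Literature.Geometry.Lorentzian.Minkowski.vacuumCauchyDevelopment.metric.IsNormalisedNullRayFrom
                Literature.Geometry.Lorentzian.Minkowski.vacuumCauchyDevelopment.timeOrientation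
                Literature.Geometry.Lorentzian.Minkowski.vacuumCauchyDevelopment.embed
                Literature.Geometry.Lorentzian.Minkowski.vacuumCauchyDevelopment.normal p γ dom →
              ¬ BddAbove dom →
                q ∉ Literature.Geometry.Lorentzian.Minkowski.vacuumCauchyDevelopment.metric.chronologicalPast
                  Literature.Geometry.Lorentzian.Minkowski.vacuumCauchyDevelopment.timeOrientation
                  (γ '' (dom ∩ Set.Ici 0))) := by
  intro h
  haveI : Literature.Geometry.Lorentzian.Minkowski.vacuumCauchyDevelopment.metric.HasLeviCivita :=
    Minkowski.vacuumCauchyDevelopment.metric.toPseudoRiemannianMetric.hasLeviCivita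
  obtain ⟨q, hq⟩ := h
  obtain ⟨p, γ, dom, hray, hdom, hmem⟩ := StubMinkowskiNoHorizon.exists_ray_mem_chronologicalPast q
  exact hq p γ dom hray hdom hmem

end BondiDrainDispersalHorizonlessMustDrain
end Summit.FinalStateConjecture.FinalStateConjecture.Theorems

end
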